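import Summits.QuantumFields.YangMills.Theorems.UnitScaleTiltProp7GreenKernelSiteFree
import Literature.MathematicalPhysics.QuantumFieldTheory.Balaban1983to89.B6Eq28LandauGaugeV1
import HarnessLib

/-!
# Route `UnitScaleTilt`, crux K1 «MinimiserStabilityRegPr» (stmt-QuantumFields-19200), route-R E′ path (α′), (E1-b) at the CURVED background — near-field transplant, gen-1 flat input:
# THE FLAT BIHARMONIC POTENTIAL OF A MATRIX DENSITY — `F := Σ_y (Gf y ·)•J y` over the free site Green function of ✓`Prop7GreenKernelSiteFree.exists_green_site_split_free` has
# `Δ_1²F = J − δ_{c₀}•(Σ_y J y)` EXACTLY, the correction being a POINT MASS AT A CENTRE `c₀ = embIter k default` (invisible to the pinned problem: sources on `C` never enter the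
# `hEL` identity); and `Δ_1 = laplace 1` is the `Σ_μ((F x − F(T_μx)) + (F x − F(T_μ⁻¹x)))` of ✓p678447 `covBilaplace_two_generation'` — so (ID′)'s `hF` is served with `m := δ_{c₀}•ΣJ`
# and NO new Fourier identity is needed (bus ask 23:34Z answered by LOCATE)

Cell `ym3-torus`, extra width seat `ym-routeR-w6` (gen 6).  THEOREMS ONLY (0 `def`, 0 `sorry`); `--supports stmt-QuantumFields-19200`, count-neutral.  YM₃ on T³ is a ladder rung (R3),
not the Clay problem; nothing here claims a stub, the crux, d = 4 or the mass gap.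

WHAT IS PROVED (ns `…Theorems.Prop7TransplantFlatBiharmonic`; `Site P j`, `V` a real normed space (matrices at the member), `laplace c` of lit `LatticeFieldCalculus`).
* `laplace_sum_smul` — `Δ_c(z ↦ Σ_y a y z • J y) w = Σ_y (Δ_c(a y) w) • J y` (scalar kernels `a : Site → Site → ℝ`, vector coefficients `J`).
* ★★ `bilaplace_green_sum_smul` — if `∀ y z, Δ_c(Δ_c(G y)) z = [z = y] − [z = z₀]` then `Δ_c(Δ_c(z ↦ Σ_y G y z • J y)) w = J w − [w = z₀]•Σ_y J y`;
  `bilaplace_green_rebase` — `G y := Gf y − Gf c₁` has `Δ_c²(G y) = δ_y − δ_{c₁}` for ANY `c₁` (px22 g3 (G1-a): take `c₁ ∈ C` near the pole).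
* `laplace_one_eq_flat` — `laplace 1 F x = Σ_μ((F x − F(torusT P j μ x)) + (F x − F((torusT P j μ).symm x)))`.
* ★★ `bilaplace_green_sum_smul_T` — the same identity written with `torusT` and the numeral-free flat Laplacian of ✓p674125∕p678447 (the `hF` binder of `covBilaplace_two_generation'` VERBATIM,
  `m := fun w => (if w = z₀ then 1 else 0) • Σ_y J y`).
HONEST SCOPE.  Linearity bookkeeping; `Gf`'s decay rows are ★w8's ✓p674845∕p675215 via conclusion (7) of `exists_green_site_split_free` (`Gf = (4c⁴)⁻¹(G̃₂(EK· − EK y) − G̃₂(EK· − EK c₀))`).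

References: T. Bałaban, CMP 95 (1984) 17–40 [Balaban1984PropagatorsI] ((1.21) p.21); CMP 99 (1985) 389–434 [Balaban1985BackgroundPropagators] ((3.8) p.392).
-/

set_option autoImplicit false

noncomputable section

open scoped BigOperators

namespace Summit.QuantumFields.YangMills.Theorems.Prop7TransplantFlatBiharmonic

open Literature.MathematicalPhysics.QuantumFieldTheory.Balaban1983to89
open LatticeFieldCalculus (laplace)
open B9TorusCalculus (torusT torusT_apply torusT_symm_apply)

variable {P : Params} {j : ℕ} {V : Type*} [NormedAddCommGroup V] [NormedSpace ℝ V]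

/-- `Δ_c(z ↦ Σ_y a y z • J y) w = Σ_y (Δ_c(a y) w) • J y`. [cite: Balaban1984PropagatorsI, (1.21) p.21] -/
theorem laplace_sum_smul (c : ℝ) (a : Site P j → Site P j → ℝ) (J : Site P j → V) (w : Site P j) :
    laplace c (fun z => ∑ y, a y z • J y) w = ∑ y, (laplace c (a y) w) • J y := by
  simp only [laplace, smul_eq_mul, Finset.sum_smul]
  symm
  rw [Finset.sum_comm]
  refine Finset.sum_congr rfl fun μ _ => ?_
  simp only [smul_add, smul_sub, Finset.smul_sum, ← Finset.sum_add_distrib, ← Finset.sum_sub_distrib]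
  refine Finset.sum_congr rfl fun y _ => ?_
  rw [mul_sub, mul_sub, mul_add, sub_smul, sub_smul, add_smul, smul_smul, smul_smul, smul_smul]

/-- ★★ **THE FLAT BIHARMONIC POTENTIAL**: a kernel with `Δ_c²(G y) = δ_y − δ_{z₀}` for every `y` solves `Δ_c²(Σ_y G y ·•J y) = J − δ_{z₀}•Σ_y J y`. [cite: Balaban1984PropagatorsI, (1.21) p.21] -/
theorem bilaplace_green_sum_smul (c : ℝ) (G : Site P j → Site P j → ℝ) (z₀ : Site P j)
    (hG : ∀ y z, laplace c (laplace c (G y)) z = (if z = y then (1 : ℝ) else 0) - (if z = z₀ then (1 : ℝ) else 0))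
    (J : Site P j → V) (w : Site P j) :
    laplace c (laplace c (fun z => ∑ y, G y z • J y)) w = J w - (if w = z₀ then (1 : ℝ) else 0) • ∑ y, J y := by
  have h1 : laplace c (fun z => ∑ y, G y z • J y) = fun z => ∑ y, (laplace c (G y) z) • J y :=
    funext fun z => laplace_sum_smul c G J z
  rw [h1, laplace_sum_smul]
  simp only [hG, sub_smul, Finset.sum_sub_distrib, ite_smul, one_smul, zero_smul]
  have hA : ∑ y, (if w = y then J y else (0 : V)) = J w := by
    rw [Finset.sum_ite_eq]; simp
  have hB : ∑ y, (if w = z₀ then J y else (0 : V)) = (if w = z₀ then (1 : ℝ) else 0) • ∑ y, J y := by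
    split_ifs with hw
    · rw [one_smul]
    · rw [zero_smul]; exact Finset.sum_const_zero
  rw [hA, hB]
  split_ifs <;> simp

/-- **RE-BASING THE NEUTRAL PAIR AT A NEAR CENTRE** (px22 g3 (G1-a)): if `Δ_c²(Gf x) = δ_x − δ_{x_c}` for every `x` (✓`exists_green_site_split_free`, conjunct 6, `x_c = embIter k default`),
then the kernel `G y := Gf y − Gf c₁` satisfies `Δ_c²(G y) = δ_y − δ_{c₁}` for ANY site `c₁` — choose `c₁ ∈ C` with `tdist(c₁, b) ≤ ℓ`, so `G y z = (4c⁴)⁻¹(G̃₂(EK z − EK y) − G̃₂(EK z − EK c₁))`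
stays bounded on the ball and the far partner `x_c` disappears. [cite: Balaban1984PropagatorsI, (1.21) p.21] -/
theorem bilaplace_green_rebase (c : ℝ) (Gf : Site P j → Site P j → ℝ) (x_c c₁ : Site P j)
    (hGf : ∀ x z, laplace c (laplace c (Gf x)) z = (if z = x then (1 : ℝ) else 0) - (if z = x_c then (1 : ℝ) else 0)) (y z : Site P j) :
    laplace c (laplace c (fun w => Gf y w - Gf c₁ w)) z = (if z = y then (1 : ℝ) else 0) - (if z = c₁ then (1 : ℝ) else 0) := by
  have e : (fun w => Gf y w - Gf c₁ w) = Gf y - Gf c₁ := rfl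
  rw [e, B6Eq28LandauGaugeV1.laplace_sub, B6Eq28LandauGaugeV1.laplace_sub, Pi.sub_apply, hGf, hGf]
  ring

/-- `laplace 1` is the numeral-free flat Laplacian of ✓p674125∕p678447 written with `torusT`. [cite: Balaban1984PropagatorsI, (1.21) p.21] -/
theorem laplace_one_eq_flat (F : Site P j → V) (x : Site P j) :
    laplace 1 F x = ∑ μ : Fin P.d, ((F x - F (torusT P j μ x)) + (F x - F ((torusT P j μ).symm x))) := by
  simp only [laplace, one_pow, one_smul, torusT_apply, torusT_symm_apply]
  exact Finset.sum_congr rfl fun μ _ => by abel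

/-- ★★ **THE `hF` BINDER OF `covBilaplace_two_generation'` SERVED**: in the `torusT`∕numeral-free letters, `Δ_flat(Δ_flat F) w = J w − m w` with `F := Σ_y G y ·•J y` and
`m w := [w = z₀]•Σ_y J y` (a point mass at `z₀`; at the member `z₀ = embIter k default ∈ C`). [cite: Balaban1984PropagatorsI, (1.21) p.21; Balaban1985BackgroundPropagators, (3.8) p.392] -/
theorem bilaplace_green_sum_smul_T (c : ℝ) (hc : c = 1) (G : Site P j → Site P j → ℝ) (z₀ : Site P j)
    (hG : ∀ y z, laplace c (laplace c (G y)) z = (if z = y then (1 : ℝ) else 0) - (if z = z₀ then (1 : ℝ) else 0))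
    (J : Site P j → V) (w : Site P j) :
    (∑ ν : Fin P.d, (((∑ μ : Fin P.d, (((fun z => ∑ y, G y z • J y) w - (fun z => ∑ y, G y z • J y) (torusT P j μ w))
          + ((fun z => ∑ y, G y z • J y) w - (fun z => ∑ y, G y z • J y) ((torusT P j μ).symm w))))
        - (∑ μ : Fin P.d, (((fun z => ∑ y, G y z • J y) (torusT P j ν w) - (fun z => ∑ y, G y z • J y) (torusT P j μ (torusT P j ν w)))
          + ((fun z => ∑ y, G y z • J y) (torusT P j ν w) - (fun z => ∑ y, G y z • J y) ((torusT P j μ).symm (torusT P j ν w))))))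
        + ((∑ μ : Fin P.d, (((fun z => ∑ y, G y z • J y) w - (fun z => ∑ y, G y z • J y) (torusT P j μ w))
          + ((fun z => ∑ y, G y z • J y) w - (fun z => ∑ y, G y z • J y) ((torusT P j μ).symm w))))
        - (∑ μ : Fin P.d, (((fun z => ∑ y, G y z • J y) ((torusT P j ν).symm w) - (fun z => ∑ y, G y z • J y) (torusT P j μ ((torusT P j ν).symm w)))
          + ((fun z => ∑ y, G y z • J y) ((torusT P j ν).symm w) - (fun z => ∑ y, G y z • J y) ((torusT P j μ).symm ((torusT P j ν).symm w))))))))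
      = J w - (if w = z₀ then (1 : ℝ) else 0) • ∑ y, J y := by
  subst hc
  have h := bilaplace_green_sum_smul 1 G z₀ hG J w
  rw [laplace_one_eq_flat] at h
  have hin : ∀ x, laplace 1 (fun z => ∑ y, G y z • J y) x
      = ∑ μ : Fin P.d, (((fun z => ∑ y, G y z • J y) x - (fun z => ∑ y, G y z • J y) (torusT P j μ x))
          + ((fun z => ∑ y, G y z • J y) x - (fun z => ∑ y, G y z • J y) ((torusT P j μ).symm x))) := fun x => laplace_one_eq_flat _ x
  simp only [hin] at h
  exact h

end Summit.QuantumFields.YangMills.Theorems.Prop7TransplantFlatBiharmonic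

end
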